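import Mathlib
import HarnessLib
import Literature.AlgebraicGeometry.Deformation.VectorBundleLifting
import Literature.AlgebraicGeometry.Motives.CrystallineRealization
import Literature.AlgebraicGeometry.Modules.SheafHomFunctor

/-!
# `PadicPridhamSemiregularity` (stmt-HodgeConjecture-13815) · Negative · stub G3 needs smoothness

Line `sigma-ob-kzero-additivity` (crux `PadicPridhamSemiregularity`, P1b), stub G3
`ConormalSheafThickeningMap`: for a smooth proper model `𝒳/W(k)` the conormal sheaf of
`X_{n+1} ↪ X_{n+2}` is `j_*𝒪_{X_k}`. MUTATION TEST (refuter-drefute-stmt-HodgeConjecture-13815-g2-0,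
2026-08-16): drop `IsSmoothProperModel d 𝒳` (its only use in G3 is flatness of `𝒳/W`) and the statement is
FALSE over the real carriers (Mathlib schemes, `SheafOfModules`, the tree's `WittScheme` tower and
`Deformation.conormalSheaf`): `conormalSheafThickeningMap_false_without_smooth`.

Witness: `p = 2`, `k = 𝔽₂`, `𝒳 = Spec k` over `W(k)` through `Spec k → Spec W/p² → Spec W` (NOT flat), `n = 0`.
Every thickening `X_m = 𝒳 ⊗_W W/p^m`, `m ≥ 1`, is `Spec k` again: `Spec W/p^m → Spec W` is a monomorphism through
which the structure map factors, so `X_m → 𝒳` is an isomorphism (`isIso_pullback_fst_of_eq_comp_mono`), hence so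
is the transition `X₁ ⟶ X₂` and its conormal sheaf is `0` (`Deformation.isZero_conormalSheaf_of_isIso`); but
`j_*𝒪_{X_k}` is not a zero object: its global sections `Γ(X_k, 𝒪)` map to a (local, non-trivial) stalk of
`X_k = Spec k ×_W Spec k ≠ ∅`, and `1 ≠ 0` there. The affine shadow `𝒪/p ⥲ p^{n+1}𝒪/p^{n+2}𝒪 iff no p-torsion`
is `Negative/StubAudit.conormalStep_false_without_torsionFree`; this file is the scheme-level statement, verbatim
G3 minus the model hypothesis. Consequence for the lead: a proof of G3 must route through
`SmoothOfRelativeDimension ⇒ Flat ⇒ 𝒪_𝒳 p-torsion-free`; `[PerfectRing k p]`, `d`, properness and the fibre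
conditions of `IsSmoothProperModel` are not what is missing here.
-/

noncomputable section

open CategoryTheory CategoryTheory.Limits AlgebraicGeometry Opposite
open Literature.AlgebraicGeometry.Motives Literature.AlgebraicGeometry.Motives.WittScheme
  Literature.AlgebraicGeometry.Deformation Literature.AlgebraicGeometry.Modules

namespace Summit.HodgeConjecture.HodgeConjecture.Theorems.PadicPridhamSemiregularity.Negative

/-- In any category: if `g = f ≫ i` with `i` a monomorphism, the first projection
`pullback g i ⟶ X` is an isomorphism. [folklore] -/
theorem isIso_pullback_fst_of_eq_comp_mono {C : Type*} [Category C] {X Z B : C} (g : X ⟶ B)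
    (f : X ⟶ Z) (i : Z ⟶ B) [Mono i] (h : g = f ≫ i) [HasPullback g i] :
    IsIso (pullback.fst g i) := by
  subst h
  infer_instance

/-- `Spec` of a surjective ring map is a monomorphism of schemes (a closed immersion). [folklore] -/
theorem mono_specMap_of_surjective {R S : CommRingCat.{0}} (f : R ⟶ S)
    (hf : Function.Surjective f.hom) : Mono (Spec.map f) := by
  haveI : IsClosedImmersion (Spec.map f) := IsClosedImmersion.spec_of_surjective _ hf
  infer_instance

/-- A pushed-forward structure sheaf `j_*𝒪_Y` is not a zero `𝒪_Z`-module as soon as `Y` has a point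
(the global section `1` maps to `1 ≠ 0` in a stalk of `Y`). [folklore] -/
theorem not_isZero_pushforward_unitModule {Y Z : Scheme.{0}} (j : Y ⟶ Z) (y : Y) :
    ¬ IsZero ((Scheme.Modules.pushforward j).obj (unitModule Y)) := by
  intro hZ
  set N := (Scheme.Modules.pushforward j).obj (unitModule Y) with hN
  -- every global section of `N` vanishes
  have hsec : ∀ x : N.val.obj (op ⊤), x = 0 := fun x => by
    have h' := congrArg (fun φ : N ⟶ N => φ.val.app (op ⊤) x) (hZ.eq_of_src (𝟙 N) 0)
    have h0 : (0 : N ⟶ N).val.app (op ⊤) x = 0 := rfl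
    exact h'.trans h0
  -- the global sections of `N` are `Γ(Y, j⁻¹Z) ∋ 1`, and `1 ≠ 0` in the stalk at `y`
  let U : Y.Opens := j ⁻¹ᵁ ⊤
  have hy : y ∈ U := trivial
  have h10 : (1 : Γ(Y, U)) = 0 := hsec (show N.val.obj (op ⊤) from (1 : Γ(Y, U)))
  have h := congrArg (Y.presheaf.germ U y hy).hom h10
  rw [map_one, map_zero] at h
  exact one_ne_zero h

/-- **The non-flat witness has an isomorphic transition `X₁ ⟶ X₂`.** For ANY prime `p` and field `k` of
characteristic `p`, the `W(k)`-scheme `𝒳 = Spec k` (structure map written as `Spec k → Spec W/p² → Spec W`)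
has `X_m = 𝒳 ⊗_W W/p^m ⥲ 𝒳` for `m = 1, 2` (`Spec W/p^m → Spec W` is a monomorphism through which the
structure map factors), hence `X₁ ⟶ X₂` is an isomorphism. [folklore] -/
theorem isIso_thickeningMap_residueWitness (p : ℕ) [Fact p.Prime] (k : Type) [Field k] [CharP k p] :
    IsIso (thickeningMap (Over.mk (Spec.map (CommRingCat.ofHom (wittQuotToResidue p k 1)) ≫
        Spec.map (CommRingCat.ofHom (algebraMap (WittVector p k) (wittQuot p k 2)))) :
          SchemeOver (WittVector p k)) (Nat.le_succ (0 + 1))) := by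
  haveI : Mono (Spec.map (CommRingCat.ofHom (algebraMap (WittVector p k) (wittQuot p k 2)))) :=
    mono_specMap_of_surjective _ Ideal.Quotient.mk_surjective
  haveI : Mono (Spec.map (CommRingCat.ofHom (algebraMap (WittVector p k) (wittQuot p k 1)))) :=
    mono_specMap_of_surjective _ Ideal.Quotient.mk_surjective
  -- the two factorisations of the structure map `Spec k → Spec W` agree
  have hfac₁₂ : Spec.map (CommRingCat.ofHom (wittQuotToResidue p k 1)) ≫
      Spec.map (CommRingCat.ofHom (algebraMap (WittVector p k) (wittQuot p k 2))) =
        Spec.map (CommRingCat.ofHom (wittQuotToResidue p k 0)) ≫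
          Spec.map (CommRingCat.ofHom (algebraMap (WittVector p k) (wittQuot p k 1))) := by
    rw [← Spec.map_comp, ← CommRingCat.ofHom_comp, wittQuotToResidue_comp_algebraMap,
      ← Spec.map_comp, ← CommRingCat.ofHom_comp, wittQuotToResidue_comp_algebraMap]
  have h2 : IsIso (pullback.fst
      (Over.mk (Spec.map (CommRingCat.ofHom (wittQuotToResidue p k 1)) ≫
        Spec.map (CommRingCat.ofHom (algebraMap (WittVector p k) (wittQuot p k 2)))) :
          SchemeOver (WittVector p k)).hom
      (Spec.map (CommRingCat.ofHom (algebraMap (WittVector p k) (wittQuot p k (0 + 1).succ))))) :=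
    isIso_pullback_fst_of_eq_comp_mono _ (Spec.map (CommRingCat.ofHom (wittQuotToResidue p k 1)))
      (Spec.map (CommRingCat.ofHom (algebraMap (WittVector p k) (wittQuot p k 2)))) rfl
  have h1 : IsIso (pullback.fst
      (Over.mk (Spec.map (CommRingCat.ofHom (wittQuotToResidue p k 1)) ≫
        Spec.map (CommRingCat.ofHom (algebraMap (WittVector p k) (wittQuot p k 2)))) :
          SchemeOver (WittVector p k)).hom
      (Spec.map (CommRingCat.ofHom (algebraMap (WittVector p k) (wittQuot p k (0 + 1)))))) :=
    isIso_pullback_fst_of_eq_comp_mono _ (Spec.map (CommRingCat.ofHom (wittQuotToResidue p k 0)))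
      (Spec.map (CommRingCat.ofHom (algebraMap (WittVector p k) (wittQuot p k 1)))) hfac₁₂
  have hfac := thickeningMap_ι (Over.mk (Spec.map (CommRingCat.ofHom (wittQuotToResidue p k 1)) ≫
    Spec.map (CommRingCat.ofHom (algebraMap (WittVector p k) (wittQuot p k 2)))) :
      SchemeOver (WittVector p k)) (Nat.le_succ (0 + 1))
  change thickeningMap _ (Nat.le_succ (0 + 1)) ≫ pullback.fst _ _ = pullback.fst _ _ at hfac
  exact @IsIso.of_isIso_fac_right _ _ _ _ _ _ _ _ h2 h1 hfac

/-- The special fibre `X_k = Spec k ×_W Spec k` of the witness has a point (the diagonal one). [folklore] -/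
theorem nonempty_specialFibre_residueWitness (p : ℕ) [Fact p.Prime] (k : Type) [Field k] [CharP k p] :
    Nonempty (specialFibre (Over.mk (Spec.map (CommRingCat.ofHom (wittQuotToResidue p k 1)) ≫
        Spec.map (CommRingCat.ofHom (algebraMap (WittVector p k) (wittQuot p k 2)))) :
          SchemeOver (WittVector p k))).left := by
  have hcc : Spec.map (CommRingCat.ofHom (wittQuotToResidue p k 1)) ≫
      Spec.map (CommRingCat.ofHom (algebraMap (WittVector p k) (wittQuot p k 2))) =
        Spec.map (CommRingCat.ofHom (WittVector.constantCoeff : WittVector p k →+* k)) := by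
    rw [← Spec.map_comp, ← CommRingCat.ofHom_comp, wittQuotToResidue_comp_algebraMap]
  exact ⟨(pullback.lift (𝟙 _) (𝟙 _)
    ((Category.id_comp _).trans (hcc.trans (Category.id_comp _).symm)) :
      Spec (CommRingCat.of k) ⟶ (specialFibre (Over.mk
        (Spec.map (CommRingCat.ofHom (wittQuotToResidue p k 1)) ≫
          Spec.map (CommRingCat.ofHom (algebraMap (WittVector p k) (wittQuot p k 2)))) :
            SchemeOver (WittVector p k))).left).base (Classical.arbitrary _)⟩

/-- **Stub G3 (`ConormalSheafThickeningMap`) is FALSE without `IsSmoothProperModel d 𝒳`**: with the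
model hypothesis dropped and everything else verbatim, the witness `𝒳 = Spec 𝔽₂ / W(𝔽₂)` (via
`Spec 𝔽₂ → Spec W/4 → Spec W`), `n = 0`, has an isomorphic transition `X₁ ⟶ X₂` (conormal sheaf `0`,
`Deformation.isZero_conormalSheaf_of_isIso`) but `j_*𝒪_{X_k} ≠ 0`. Flatness of `𝒳/W` (from smoothness)
is load-bearing in G3. [folklore] -/
theorem conormalSheafThickeningMap_false_without_smooth :
    ¬ ∀ (p : ℕ) [Fact p.Prime] (k : Type) [Field k] [CharP k p] [PerfectRing k p]
        (𝒳 : SchemeOver (WittVector p k)) (n : ℕ),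
        Nonempty (conormalSheaf (thickeningMap 𝒳 (Nat.le_succ (n + 1))) ≅
          (Scheme.Modules.pushforward (specialFibreToThickening 𝒳 n)).obj
            (unitModule (specialFibre 𝒳).left)) := by
  intro h
  obtain ⟨e⟩ := h 2 (ZMod 2) (Over.mk (Spec.map (CommRingCat.ofHom (wittQuotToResidue 2 (ZMod 2) 1)) ≫
    Spec.map (CommRingCat.ofHom (algebraMap (WittVector 2 (ZMod 2)) (wittQuot 2 (ZMod 2) 2))))) 0
  obtain ⟨y⟩ := nonempty_specialFibre_residueWitness 2 (ZMod 2)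
  haveI := isIso_thickeningMap_residueWitness 2 (ZMod 2)
  exact not_isZero_pushforward_unitModule _ y ((isZero_conormalSheaf_of_isIso _).of_iso e.symm)

end Summit.HodgeConjecture.HodgeConjecture.Theorems.PadicPridhamSemiregularity.Negative

end
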